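/-
Copyright (c) 2026 the pub-hodgecm-mathlib formalisation cell (harness21).  Prover seat hodgecm-mathlib-K2E1-p12 (g4) (free E1 analytic hand spilled to S8 per LEAD #21),
Track B ∕ K2-LIT, h413 = `stmt-HodgeConjecture-24833`, R90-TF section S8 «ContSpec-n½», deal S8-R60 (2026-09-04T22:39:51Z): the N = 3 TWIN of ★ p862491
`R90S8ResHResiduesOrthogonalWavePacketsU2` (K2E1-p15) ON MOK'S CARRIER `quasiSplit L⁺ L c 3` (G-SIDE SEAM RULE S8-R51) — letter (O₃) `hO` of ★ F1_qs p862541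
`residualG_le_topologicalClosure_of_letters_quasiSplit`, keyed to ★ G-DEFS `R90S8ResGBlockDataU3Defs` (K2E1-p11 (g3)): RESIDUE ATOMS ⟂ LINE PARTS across Borel blocks.
-/
import Summits.HodgeConjecture.HodgeConjecture.Theorems.R90S8ResGBlockDataU3Defs   -- ★ G-DEFS (K2E1-p11 (g3)): `resGBlock K' ω χ₁ χ₂` ∕ `resGAtom U …` (+ `Top`∕`Mid` slots) ∕ `resGLine U …`, `isOrtho_resGAtom_resGLine`, `resGAtom_le_resGBlock`, `resGLine_le_resGBlock`, `resGAtomTop∕Mid_le_resGAtom`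
import HarnessLib

/-!
# S8 #2 road (G side), letter (O₃) — `R90S8ResGResiduesOrthogonalWavePacketsU3`: `(⨆_b At(U_b; K′, ω; χ₁ᵇ, χ₂ᵇ)) ⟂ (⨆_b Ln(U_b; K′, ω; χ₁ᵇ, χ₂ᵇ))` — the orthogonality
# letter `hO` of ★ F1_qs `residualG_le_topologicalClosure_of_letters_quasiSplit`, in regime R1 on `U_{L∕L⁺}(3) = quasiSplit L⁺ L c 3` (N = 3 twin of ★ p862491)

Track B ∕ K2-LIT, crux h413 = `stmt-HodgeConjecture-24833`, route of record `HCCMUnconditional`; cell `hodgecm-mathlib`, R90-TF programme, section S8 «ContSpec-n½», socket #2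
`sock_S8_res_classification` (B ED. 4 :205–:214; chain F1_qs ⟹ F2 ⟹ #2).  THEOREMS ONLY (no `def`, no `instance`, no `notation`, no named-fact hypothesis, no `sorry`; default
heartbeats); lane `--supports stmt-HodgeConjecture-24833 --as helper` (count-neutral).  CLOSES NO SOCKET: it pays the SHAPE of letter (O₃) `hO : ∀ i, (⨆ b, At i b) ⟂ (⨆ b, Ln i b)` (★ F1_qs
`R90S8ResGLeClosureOfLettersU3.lean` :149) at the defs of record `At i b := resGAtom L μ (U i b) (K' i) (ω i) (χ₁ b) (χ₂ b)`, `Ln i b := resGLine L μ (U i b) (K' i) (ω i) (χ₁ b) (χ₂ b)` (regime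
R1, S8-R35 (1)), GENERIC in the level datum `(K', ω)` (LETTER SHAPE RULE S8-R29 (2)), for an ARBITRARY three-slot block-model family `U b : L² →ₗ[ℂ] (A b × M b) × Λ b` and an ARBITRARY
block index `β` with Borel data `(χ₁ b, χ₂ b)`, modulo the visible letters listed below.

THE MATHEMATICS ([MoeglinWaldspurger1995, II.2.1 (pseudo-Eisenstein series of non-associate cuspidal data are orthogonal), VI.2]; [Rogawski1990, §13.9 p. 229]).  In regime R1 the line
part of a block is the orthocomplement of its atoms INSIDE the block, `Ln_b = Sc_b ⊓ At_bᗮ` (★ D3), so `At_b ⟂ Ln_b` holds by definition (★ read-back `isOrtho_resGAtom_resGLine`).  Across two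
blocks `b ≠ b′`: if the Borel data `(χ₁ᵇ, χ₂ᵇ)`, `(χ₁ᵇ′, χ₂ᵇ′)` are NOT ASSOCIATE (under the order-two Weyl group of the Borel torus `T ≅ L^× × U(1)` of `U(2,1)`), the whole blocks are
orthogonal, `At_b ≤ Sc_b ⟂ Sc_{b′} ≥ Ln_{b′}` [MW II.2.1]; if they ARE associate with `b ≠ b′` (the two blocks then COINCIDE and block orthogonality cannot serve), the model has no atom
coordinates at `b`: `At_b = ⊥` (the model letter `hOD`, as on the H side).  Hence `(⨆_b At_b) ⟂ (⨆_b Ln_b)` (Mathlib `Submodule.isOrtho_iSup_left ∕ _right`).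

CENSUS FINDING (S8-R60 «census says whether R6 is N-generic or N = 2-only»): ★ R6 `isOrtho_topologicalClosure_span_family_of_rayTrivial_of_ne`
(`K2E1ChiPseudoEisensteinFamiliesOrthogonalRayTrivialCMTwo`) — the payer of block orthogonality on the H side — is N = 2-ONLY (`quasiSplit … 2`, `chiSectionSpace χ`, the CMTwo
inner-product∕radial files); there is NO `chiSectionSpacePair` (N = 3) twin in the tree.  Therefore §2 here carries the N = 3 block orthogonality as a VISIBLE LETTER `hBO` whose bytes are
`resGBlock L μ K' ω (χ₁ b) (χ₂ b) ⟂ resGBlock L μ K' ω (χ₁ b') (χ₂ b')` — by ★ `resGBlock_def` (`rfl`) exactly the conclusion the future R6₃ will have (closed spans of the two wave-packet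
families) — split from the model letter `hOD` by an ABSTRACT associate relation `Assoc : β → β → Prop` (the payer of `hBO` fixes `Assoc b b′ :↔ (χ₁ᵇ, χ₂ᵇ) = w·(χ₁ᵇ′, χ₂ᵇ′)`).
* §1 `isOrtho_iSup_resGAtom_iSup_resGLine_of_pairwise` — GENERIC ASSEMBLY: the pairwise cross-block clause `∀ b ≠ b′, At_b ⟂ Sc_{b′}` gives `hO`'s shape; the slot forms for `At_top`∕`At_mid`
  (a consumer may take `At := resGAtomTop` and put the middle atoms into `Bn`); `resGAtom_isOrtho_resGBlock_of_isOrtho` (from block orthogonality) and `resGAtom_isOrtho_of_eq_bot` (from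
  `At = ⊥`) discharge the clause.
* §2 **`isOrtho_iSup_resGAtom_iSup_resGLine_of_letters`** — THE PAYMENT SHAPE modulo the two visible letters `hBO` (block orthogonality of non-associate data — the R6₃ debt of the E1 estate) and
  `hOD` (associate blocks carry no atom coordinates — the model letter); slot forms `…resGAtomTop…` ∕ `…resGAtomMid…`.
CONSUMER (F1_qs): `hO := fun i => isOrtho_iSup_resGAtom_iSup_resGLine_of_letters L μ (U i) (K' i) (ω i) χ₁ χ₂ Assoc (hBO i) (hOD i)`.
HONEST LABEL: HC_CM is proved only modulo the 7 printed citations (2 remaining named inputs: hLiu418 = `stmt-HodgeConjecture-24832`, h413 = `stmt-HodgeConjecture-24833`) until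
rung 0 closes; REL ≠ ★ ≠ BUILT; this file asserts no named fact, is conditional by construction on its visible binders (`hsep` ∕ `hBO`, `hOD`), and closes no socket; count-neutral.

## References
* [MoeglinWaldspurger1995] C. Mœglin, J.-L. Waldspurger, *Spectral Decomposition and Eisenstein Series* (1995), II.2.1, VI.2.
* [Rogawski1990] J. D. Rogawski, *Automorphic Representations of Unitary Groups in Three Variables* (1990), §13.9 p. 229.
* [Langlands1976] R. P. Langlands, *On the Functional Equations Satisfied by Eisenstein Series*, LNM 544 (1976), §7.
-/

set_option autoImplicit false
set_option linter.dupNamespace false  -- the mandated namespace `…HodgeConjecture.HodgeConjecture.R90.S8` (LEAD #1 L1) repeats the summit's segment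

noncomputable section

open MeasureTheory Measure Set Filter Topology NumberField
open Literature.NumberTheory.Automorphic Literature.NumberTheory.Automorphic.UnitaryGroup Literature.NumberTheory.GaloisRepresentations AdelicGroupData
open Literature.NumberTheory.Automorphic.Arthur2013.Leaves.TECR
open scoped ENNReal NNReal InnerProductSpace

namespace Summit.HodgeConjecture.HodgeConjecture.R90.S8

variable (L : Type) [Field L] [NumberField L] [IsCMField L]
  (μ : Measure (quasiSplit (↥(maximalRealSubfield L)) L (IsCMField.complexConj L) 3).automorphicQuotient)

/-! ## §1 Generic assembly: pairwise cross-block orthogonality ⟹ `(⨆ At) ⟂ (⨆ Ln)` [MW95 VI.2] -/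

section Assembly

variable {β : Type*} {A M Λ : β → Type*} [∀ b, AddCommGroup (A b)] [∀ b, Module ℂ (A b)] [∀ b, AddCommGroup (M b)] [∀ b, Module ℂ (M b)]
  [∀ b, AddCommGroup (Λ b)] [∀ b, Module ℂ (Λ b)]
  (U : ∀ b : β, (quasiSplit (↥(maximalRealSubfield L)) L (IsCMField.complexConj L) 3).L2 μ →ₗ[ℂ] (A b × M b) × Λ b)
  (K' : Subgroup (quasiSplit (↥(maximalRealSubfield L)) L (IsCMField.complexConj L) 3).Adelic) (ω : ↥K' →* ℂ)
  (χ₁ : β → HeckeCharacter L) (χ₂ : β → (↥(TorusDict.torus (IsCMField.complexConj L)) →ₜ* ℂˣ))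

/-- **GENERIC ASSEMBLY OF (O₃)**: for any three-slot block-model family `U b`, any level datum `(K′, ω)` and any Borel data `b ↦ (χ₁ b, χ₂ b)`, if the atoms of each block are orthogonal to
every OTHER block (`∀ b ≠ b′, At_b ⟂ Sc_{b′}`), then `(⨆_b At_b) ⟂ (⨆_b Ln_b)` — in-block by ★ `isOrtho_resGAtom_resGLine` (`Ln_b = Sc_b ⊓ At_bᗮ`), cross-block because `Ln_{b′} ≤ Sc_{b′}`.
[cite: MoeglinWaldspurger1995, VI.2] -/
theorem isOrtho_iSup_resGAtom_iSup_resGLine_of_pairwise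
    (hsep : ∀ b b' : β, b ≠ b' → resGAtom L μ (U b) K' ω (χ₁ b) (χ₂ b) ⟂ resGBlock L μ K' ω (χ₁ b') (χ₂ b')) :
    (⨆ b, resGAtom L μ (U b) K' ω (χ₁ b) (χ₂ b)) ⟂ (⨆ b, resGLine L μ (U b) K' ω (χ₁ b) (χ₂ b)) := by
  classical
  refine Submodule.isOrtho_iSup_left.2 fun b => Submodule.isOrtho_iSup_right.2 fun b' => ?_
  by_cases h : b = b'
  · subst h
    exact isOrtho_resGAtom_resGLine L μ (U b) K' ω (χ₁ b) (χ₂ b)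
  · exact (hsep b b' h).mono_right (resGLine_le_resGBlock L μ (U b') K' ω (χ₁ b') (χ₂ b'))

/-- Slot form (TOP-pole atoms, case (i) of §13.9: the character lines): `(⨆_b At_top,b) ⟂ (⨆_b Ln_b)` under the same pairwise clause (`At_top ≤ At`, ★ `resGAtomTop_le_resGAtom`).
[cite: MoeglinWaldspurger1995, VI.2] [cite: Rogawski1990, §13.9 p. 229] -/
theorem isOrtho_iSup_resGAtomTop_iSup_resGLine_of_pairwise
    (hsep : ∀ b b' : β, b ≠ b' → resGAtom L μ (U b) K' ω (χ₁ b) (χ₂ b) ⟂ resGBlock L μ K' ω (χ₁ b') (χ₂ b')) :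
    (⨆ b, resGAtomTop L μ (U b) K' ω (χ₁ b) (χ₂ b)) ⟂ (⨆ b, resGLine L μ (U b) K' ω (χ₁ b) (χ₂ b)) :=
  (isOrtho_iSup_resGAtom_iSup_resGLine_of_pairwise L μ U K' ω χ₁ χ₂ hsep).mono_left
    (iSup_mono fun b => resGAtomTop_le_resGAtom L μ (U b) K' ω (χ₁ b) (χ₂ b))

/-- Slot form (MIDDLE-pole atoms, case (ii) of §13.9: the `πⁿ(ξ)`-blocks): `(⨆_b At_mid,b) ⟂ (⨆_b Ln_b)` under the same pairwise clause (`At_mid ≤ At`, ★ `resGAtomMid_le_resGAtom`).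
[cite: MoeglinWaldspurger1995, VI.2] [cite: Rogawski1990, §13.9 p. 229] -/
theorem isOrtho_iSup_resGAtomMid_iSup_resGLine_of_pairwise
    (hsep : ∀ b b' : β, b ≠ b' → resGAtom L μ (U b) K' ω (χ₁ b) (χ₂ b) ⟂ resGBlock L μ K' ω (χ₁ b') (χ₂ b')) :
    (⨆ b, resGAtomMid L μ (U b) K' ω (χ₁ b) (χ₂ b)) ⟂ (⨆ b, resGLine L μ (U b) K' ω (χ₁ b) (χ₂ b)) :=
  (isOrtho_iSup_resGAtom_iSup_resGLine_of_pairwise L μ U K' ω χ₁ χ₂ hsep).mono_left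
    (iSup_mono fun b => resGAtomMid_le_resGAtom L μ (U b) K' ω (χ₁ b) (χ₂ b))

end Assembly

section Pair

variable {A M Λ : Type*} [AddCommGroup A] [Module ℂ A] [AddCommGroup M] [Module ℂ M] [AddCommGroup Λ] [Module ℂ Λ]
  (U : (quasiSplit (↥(maximalRealSubfield L)) L (IsCMField.complexConj L) 3).L2 μ →ₗ[ℂ] (A × M) × Λ)
  (K' : Subgroup (quasiSplit (↥(maximalRealSubfield L)) L (IsCMField.complexConj L) 3).Adelic) (ω : ↥K' →* ℂ)

/-- The cross-block clause from BLOCK ORTHOGONALITY: `Sc ⟂ Sc′ ⟹ At ⟂ Sc′` (`At ≤ Sc`, ★ `resGAtom_le_resGBlock`). [cite: MoeglinWaldspurger1995, II.2.1] -/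
theorem resGAtom_isOrtho_resGBlock_of_isOrtho {χ₁ χ₁' : HeckeCharacter L} {χ₂ χ₂' : ↥(TorusDict.torus (IsCMField.complexConj L)) →ₜ* ℂˣ}
    (h : resGBlock L μ K' ω χ₁ χ₂ ⟂ resGBlock L μ K' ω χ₁' χ₂') :
    resGAtom L μ U K' ω χ₁ χ₂ ⟂ resGBlock L μ K' ω χ₁' χ₂' :=
  h.mono_left (resGAtom_le_resGBlock L μ U K' ω χ₁ χ₂)

/-- The cross-block clause for a block WITHOUT ATOM COORDINATES: `At = ⊥ ⟹ At ⟂ V` for every `V` (associate blocks). [folklore] -/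
theorem resGAtom_isOrtho_of_eq_bot {χ₁ : HeckeCharacter L} {χ₂ : ↥(TorusDict.torus (IsCMField.complexConj L)) →ₜ* ℂˣ} (h : resGAtom L μ U K' ω χ₁ χ₂ = ⊥)
    (V : Submodule ℂ ((quasiSplit (↥(maximalRealSubfield L)) L (IsCMField.complexConj L) 3).L2 μ)) : resGAtom L μ U K' ω χ₁ χ₂ ⟂ V := by
  rw [h]
  exact Submodule.isOrtho_bot_left

end Pair

/-! ## §2 The payment shape modulo the visible letters `hBO` (block orthogonality of non-associate Borel data, the R6₃ debt) and `hOD` (associate blocks have no atoms) -/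

section Payment

variable {β : Type*} {A M Λ : β → Type*} [∀ b, AddCommGroup (A b)] [∀ b, Module ℂ (A b)] [∀ b, AddCommGroup (M b)] [∀ b, Module ℂ (M b)]
  [∀ b, AddCommGroup (Λ b)] [∀ b, Module ℂ (Λ b)]
  (U : ∀ b : β, (quasiSplit (↥(maximalRealSubfield L)) L (IsCMField.complexConj L) 3).L2 μ →ₗ[ℂ] (A b × M b) × Λ b)
  (K' : Subgroup (quasiSplit (↥(maximalRealSubfield L)) L (IsCMField.complexConj L) 3).Adelic) (ω : ↥K' →* ℂ)
  (χ₁ : β → HeckeCharacter L) (χ₂ : β → (↥(TorusDict.torus (IsCMField.complexConj L)) →ₜ* ℂˣ))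
  (Assoc : β → β → Prop)

/-- **LETTER (O₃) — PAYMENT SHAPE**: at a level datum `(K′, ω)`, for a three-slot block-model family `U b` over any block index `β` with Borel data `(χ₁ b, χ₂ b)` and an associate relation
`Assoc`, `(⨆_b At_b) ⟂ (⨆_b Ln_b)` — the bytes of `hO i` of ★ F1_qs `residualG_le_topologicalClosure_of_letters_quasiSplit` at `At i b := resGAtom L μ (U i b) (K' i) (ω i) (χ₁ b) (χ₂ b)`,
`Ln i b := resGLine …`.  VISIBLE LETTERS: `hBO` — NON-ASSOCIATE data give ORTHOGONAL BLOCKS [MW II.2.1] (at N = 2 this is ★ R6 `isOrtho_topologicalClosure_span_family_of_rayTrivial_of_ne`; at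
N = 3 it is the E1 estate's R6₃ debt for ★ `chiSectionSpacePair`, bytes = `resGBlock … ⟂ resGBlock …`), and the model letter `hOD` (an associate block `b′ ≠ b` carries no atom coordinates at
`b`: `At_b = ⊥`).  Proof: §1 with, for `b ≠ b′`, either `hOD` or `hBO`. [cite: MoeglinWaldspurger1995, II.2.1, VI.2] [cite: Rogawski1990, §13.9 p. 229] -/
theorem isOrtho_iSup_resGAtom_iSup_resGLine_of_letters
    (hBO : ∀ b b' : β, b ≠ b' → ¬ Assoc b b' → resGBlock L μ K' ω (χ₁ b) (χ₂ b) ⟂ resGBlock L μ K' ω (χ₁ b') (χ₂ b'))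
    (hOD : ∀ b b' : β, b ≠ b' → Assoc b b' → resGAtom L μ (U b) K' ω (χ₁ b) (χ₂ b) = ⊥) :
    (⨆ b, resGAtom L μ (U b) K' ω (χ₁ b) (χ₂ b)) ⟂ (⨆ b, resGLine L μ (U b) K' ω (χ₁ b) (χ₂ b)) := by
  refine isOrtho_iSup_resGAtom_iSup_resGLine_of_pairwise L μ U K' ω χ₁ χ₂ fun b b' hne => ?_
  by_cases hw : Assoc b b'
  · exact resGAtom_isOrtho_of_eq_bot L μ (U b) K' ω (hOD b b' hne hw) _
  · exact resGAtom_isOrtho_resGBlock_of_isOrtho L μ (U b) K' ω (hBO b b' hne hw)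

/-- Slot form of the payment (TOP-pole atoms): `(⨆_b At_top,b) ⟂ (⨆_b Ln_b)` modulo `hBO`, `hOD`. [cite: MoeglinWaldspurger1995, II.2.1, VI.2] [cite: Rogawski1990, §13.9 p. 229] -/
theorem isOrtho_iSup_resGAtomTop_iSup_resGLine_of_letters
    (hBO : ∀ b b' : β, b ≠ b' → ¬ Assoc b b' → resGBlock L μ K' ω (χ₁ b) (χ₂ b) ⟂ resGBlock L μ K' ω (χ₁ b') (χ₂ b'))
    (hOD : ∀ b b' : β, b ≠ b' → Assoc b b' → resGAtom L μ (U b) K' ω (χ₁ b) (χ₂ b) = ⊥) :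
    (⨆ b, resGAtomTop L μ (U b) K' ω (χ₁ b) (χ₂ b)) ⟂ (⨆ b, resGLine L μ (U b) K' ω (χ₁ b) (χ₂ b)) :=
  (isOrtho_iSup_resGAtom_iSup_resGLine_of_letters L μ U K' ω χ₁ χ₂ Assoc hBO hOD).mono_left
    (iSup_mono fun b => resGAtomTop_le_resGAtom L μ (U b) K' ω (χ₁ b) (χ₂ b))

/-- Slot form of the payment (MIDDLE-pole atoms): `(⨆_b At_mid,b) ⟂ (⨆_b Ln_b)` modulo `hBO`, `hOD`. [cite: MoeglinWaldspurger1995, II.2.1, VI.2] [cite: Rogawski1990, §13.9 p. 229] -/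
theorem isOrtho_iSup_resGAtomMid_iSup_resGLine_of_letters
    (hBO : ∀ b b' : β, b ≠ b' → ¬ Assoc b b' → resGBlock L μ K' ω (χ₁ b) (χ₂ b) ⟂ resGBlock L μ K' ω (χ₁ b') (χ₂ b'))
    (hOD : ∀ b b' : β, b ≠ b' → Assoc b b' → resGAtom L μ (U b) K' ω (χ₁ b) (χ₂ b) = ⊥) :
    (⨆ b, resGAtomMid L μ (U b) K' ω (χ₁ b) (χ₂ b)) ⟂ (⨆ b, resGLine L μ (U b) K' ω (χ₁ b) (χ₂ b)) :=
  (isOrtho_iSup_resGAtom_iSup_resGLine_of_letters L μ U K' ω χ₁ χ₂ Assoc hBO hOD).mono_left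
    (iSup_mono fun b => resGAtomMid_le_resGAtom L μ (U b) K' ω (χ₁ b) (χ₂ b))

/-- **The same with ORTHOGONAL BLOCKS THROUGHOUT** (no associate pair in the index — e.g. an index of Weyl-orbit representatives): `hBO` for all `b ≠ b′` alone gives `(⨆_b At_b) ⟂ (⨆_b Ln_b)`.
[cite: MoeglinWaldspurger1995, II.2.1, VI.2] -/
theorem isOrtho_iSup_resGAtom_iSup_resGLine_of_isOrtho_blocks
    (hBO : ∀ b b' : β, b ≠ b' → resGBlock L μ K' ω (χ₁ b) (χ₂ b) ⟂ resGBlock L μ K' ω (χ₁ b') (χ₂ b')) :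
    (⨆ b, resGAtom L μ (U b) K' ω (χ₁ b) (χ₂ b)) ⟂ (⨆ b, resGLine L μ (U b) K' ω (χ₁ b) (χ₂ b)) :=
  isOrtho_iSup_resGAtom_iSup_resGLine_of_pairwise L μ U K' ω χ₁ χ₂ fun b b' hne =>
    resGAtom_isOrtho_resGBlock_of_isOrtho L μ (U b) K' ω (hBO b b' hne)

end Payment

end Summit.HodgeConjecture.HodgeConjecture.R90.S8

end
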